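import Literature.Probability.RandomPlanarGeometry.SAWRestrictionCovariance
import Literature.Probability.RandomPlanarGeometry.SAWExcursionAvoidance
import Literature.Probability.LatticeModels.StarCrossing
import Summits.CriticalPhenomena.SAWScalingLimit.Theses.SAWRenewalTightness

/-!
# Crux `ConfinementPositivity` (stmt-CriticalPhenomena-17587) — ideator 1 sketch (round 1)

Typed first lemmas for the two idea cards `restriction-cascade` and `excursion-domination`.
Both rest on ONE exact identity of the critical SAW law: restriction covariance makes confinement
probabilities MULTIPLICATIVE along any chain of nested domains (`conf_chain`), so that
`Z_{D'}/Z_D = ∏ᵢ (1 - hᵢ)` with `hᵢ` = probability that the walk of the `i`-th intermediate domain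
visits the piece removed at step `i`.  A LOWER bound on the crux's ratio is thereby an UPPER bound
on visiting probabilities of boundary pieces.  Nothing here is proved; every `sorry` is a stub of a
line, `lean check` only certifies that the statements elaborate over existing declarations.
-/

noncomputable section

namespace Summit.CriticalPhenomena.SAWScalingLimit.Cruxes.ConfinementPositivity.Ideator1

open MeasureTheory Set Metric Filter Topology
open scoped ENNReal
open Literature.Probability.RandomPlanarGeometry Literature.Probability.LatticeModels
open Literature.Probability.Percolation

/-! ### The cascade identity (exact restriction covariance) -/

/-- The confinement event: the walk of `Ω_δ` is (with the same support) a walk of `Ω'_δ`. -/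
def Conf (Ω Ω' : Set ℂ) (δ : ℝ) (u v : Site 2) : Set (SAW.DomainSAW Ω δ u v) :=
  {γ | ∃ γ' : SAW.DomainSAW Ω' δ u v, γ'.walk.support = γ.walk.support}

/-- Nesting of the walk spaces: every `Ω'_δ`-walk is an `Ω_δ`-walk with the same support. -/
def Nested (Ω' Ω : Set ℂ) (δ : ℝ) (u v : Site 2) : Prop :=
  ∀ γ' : SAW.DomainSAW Ω' δ u v, ∃ γ : SAW.DomainSAW Ω δ u v, γ.walk.support = γ'.walk.support

/-- **L0 (provable now, the cascade identity).** Confinement probabilities are multiplicative along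
chains `Ω'' ⊆ Ω' ⊆ Ω`: `P_Ω[γ ⊆ Ω''] = P_Ω[γ ⊆ Ω'] · P_{Ω'}[γ ⊆ Ω'']` as soon as `0 < Z_{Ω'} < ∞`
(both sides are `Z_Ω⁻¹ Z_{Ω''}` by `SAW.law_setOf_exists_support_eq_eq`). Iterated, it gives
`Z_{D'}/Z_D = ∏ᵢ P_{Uᵢ}[γ ⊆ U_{i+1}] = ∏ᵢ (1 - P_{Uᵢ}[γ visits Uᵢ ∖ U_{i+1}])`. -/
theorem conf_chain (Ω'' Ω' Ω : Set ℂ) (δ : ℝ) (u v : Site 2)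
    (h₁ : Nested Ω'' Ω' δ u v) (h₂ : Nested Ω' Ω δ u v)
    (hfin : SAW.weight Ω' δ u v Set.univ ≠ ⊤) (hpos : SAW.weight Ω' δ u v Set.univ ≠ 0) :
    SAW.law Ω δ u v (Conf Ω Ω'' δ u v) =
      SAW.law Ω δ u v (Conf Ω Ω' δ u v) * SAW.law Ω' δ u v (Conf Ω' Ω'' δ u v) := by
  sorry

/-- The visiting probability of a set of lattice sites under the critical SAW law of `Ω_δ`. -/
def visitProb (Ω : Set ℂ) (δ : ℝ) (u v : Site 2) (S : Set (Site 2)) : ℝ≥0∞ :=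
  SAW.law Ω δ u v {γ | ∃ w ∈ γ.walk.support, w ∈ S}

/-- **L0' (provable now, one peeling step).** If every `Ω_δ`-walk avoiding the site set `S` is an
`Ω'_δ`-walk, then `P_Ω[γ ⊆ Ω'] ≥ 1 - P_Ω[γ visits S]` (for a probability law). -/
theorem conf_ge_one_sub_visit (Ω Ω' : Set ℂ) (δ : ℝ) (u v : Site 2) (S : Set (Site 2))
    (hS : ∀ γ : SAW.DomainSAW Ω δ u v, (∀ w ∈ γ.walk.support, w ∉ S) →
      ∃ γ' : SAW.DomainSAW Ω' δ u v, γ'.walk.support = γ.walk.support)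
    (hP : IsProbabilityMeasure (SAW.law Ω δ u v)) :
    1 - visitProb Ω δ u v S ≤ SAW.law Ω δ u v (Conf Ω Ω' δ u v) := by
  sorry

/-! ### Card `excursion-domination`: the atom and the two random-walk inputs -/

/-- The visiting probability of a site `w` by the simple-random-walk EXCURSION of the graph `Gr` from
`u` to `v` (walk killed at its first non-`Gr` step, paths ending at `v`): by the strong Markov
property it is `G(u,w) G(w,v) / (G(w,w) G(u,v))` with `G = SRWExcursion.killedGreen Gr`. -/
def rwVisit (Gr : SimpleGraph (Site 2)) (u v w : Site 2) : ℝ :=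
  SRWExcursion.killedGreen Gr u w * SRWExcursion.killedGreen Gr w v /
    (SRWExcursion.killedGreen Gr w w * SRWExcursion.killedGreen Gr u v)

/-- The polygonal realisation of a lattice graph at mesh `δ`: all closed edge segments of `Gr`
together with every closed lattice cell whose four sides are edges of `Gr` (Chelkak 2016, §2.1
"polygonal representation"; a discrete domain is SIMPLY CONNECTED iff this set is). -/
def cellRealisation (Gr : SimpleGraph (Site 2)) (δ : ℝ) : Set ℂ :=
  (⋃ (x : Site 2) (y : Site 2) (_ : Gr.Adj x y), segment ℝ (meshPoint δ x) (meshPoint δ y)) ∪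
  (⋃ (x : Site 2) (_ : Gr.Adj x (x + ![1, 0]) ∧ Gr.Adj x (x + ![0, 1]) ∧
      Gr.Adj (x + ![1, 0]) (x + ![1, 1]) ∧ Gr.Adj (x + ![0, 1]) (x + ![1, 1])),
    (Set.Icc (δ * (x 0 : ℝ)) (δ * (x 0 + 1 : ℝ)) ×ℂ Set.Icc (δ * (x 1 : ℝ)) (δ * (x 1 + 1 : ℝ))))

/-- Graph-level simple connectivity of the discrete domain `Ω_δ` (no handles: every cycle of the
domain graph bounds cells of the domain).  LOAD-BEARING for the atom below. -/
def MeshSimplyConnected (Ω : Set ℂ) (δ : ℝ) : Prop :=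
  SimplyConnectedSpace (cellRealisation (discreteDomainGraph Ω δ) δ)

/-- **THE ATOM `ExcursionDomination` (open; conjectured here).** There is an absolute constant `C`
such that for EVERY bounded `Ω`, mesh `δ > 0`, endpoints `u, v` and every boundary site `w` of
`Ω_δ` (a site of the discrete domain with a lattice neighbour outside it) other than `u, v`, the
critical SAW of `Ω_δ` from `u` to `v` visits `w` with probability at most `C` times the probability
that the random-walk excursion of `Ω_δ` from `u` to `v` visits `w`.  Continuum reason: both laws are
restriction-covariant, and all restriction measures share the same boundary hitting kernel, with
intensity proportional to the exponent (`5/8` for the SAW, `1` for the excursion; LSW 2003).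
SIMPLE CONNECTIVITY IS LOAD-BEARING: with a handle (a long width-`k` corridor as an ALTERNATIVE route) the
SAW threads it at rate `μ_k/μ` per unit length while the killed walk pays `e^{-π/k}`-type rates, and the
ratio is unbounded (one-strand threading has an `α`-dependent rate); dead ends and mandatory passages
are harmless (two-strand rate universal / both sure).  Exact enumeration (W = 4, L = 4, 6, 8) gives the
ratio `≤ 0.88` at every site. -/
def ExcursionDomination : Prop :=
  ∃ C : ℝ, 0 < C ∧ ∀ (Ω : Set ℂ) (δ : ℝ) (u v w : Site 2), Bornology.IsBounded Ω → 0 < δ →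
    MeshSimplyConnected Ω δ →                                   -- no handles (load-bearing)
    w ∈ meshDomain Ω δ →
    (∃ w' : Site 2, Literature.Probability.LatticeModels.zdStarGraph.Adj w w' ∧ w' ∉ meshDomain Ω δ) →
    w ≠ u → w ≠ v →
      (SAW.law Ω δ u v {γ | w ∈ γ.walk.support}).toReal ≤
        C * rwVisit (discreteDomainGraph Ω δ) u v w

/-- **RW input 1 `RWConfinement` (discrete potential theory; provable with Chelkak's toolbox).**
Random-walk-excursion confinement positivity for socketed nested Dobrushin domains: the killed Green
functions satisfy `G_{D'_δ}(a_δ,b_δ) ≥ c₀ · G_{D_δ}(a_δ,b_δ)` for all small `δ`. -/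
def RWConfinement : Prop :=
  ∀ (D D' : DobrushinDomain) (a b : ℝ → Site 2) (d : ℝ), 0 < d → D'.carrier ⊆ D.carrier →
    D'.pt 0 = D.pt 0 → D'.pt 1 = D.pt 1 →
    D.carrier ∩ (Metric.ball (D.pt 0) d ∪ Metric.ball (D.pt 1) d) ⊆ D'.carrier →
    SAW.IsEndpointApprox D' a b →
      ∃ c₀ δ₀ : ℝ, 0 < c₀ ∧ 0 < δ₀ ∧ ∀ δ ∈ Set.Ioc (0 : ℝ) δ₀,
        c₀ * SRWExcursion.killedGreen (discreteDomainGraph D.carrier δ) (a δ) (b δ) ≤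
          SRWExcursion.killedGreen (discreteDomainGraph D'.carrier δ) (a δ) (b δ)

/-- **RW input 2 `RWVisitSmall` (discrete potential theory).** Along the peeling, no single site is
nearly forced for the excursion: for every `η > 0`, for small `δ`, every intermediate domain `Ω`
(`D' ⊆ Ω ⊆ D`) and every site `w` of `Ω_δ` outside the socket balls, `rwVisit ≤ η`. -/
def RWVisitSmall : Prop :=
  ∀ (D D' : DobrushinDomain) (a b : ℝ → Site 2) (d : ℝ), 0 < d → D'.carrier ⊆ D.carrier →
    D'.pt 0 = D.pt 0 → D'.pt 1 = D.pt 1 →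
    D.carrier ∩ (Metric.ball (D.pt 0) d ∪ Metric.ball (D.pt 1) d) ⊆ D'.carrier →
    SAW.IsEndpointApprox D' a b →
      ∀ η : ℝ, 0 < η → ∃ δ₀ : ℝ, 0 < δ₀ ∧ ∀ δ ∈ Set.Ioc (0 : ℝ) δ₀, ∀ (Ω : Set ℂ) (w : Site 2),
        D'.carrier ⊆ Ω → Ω ⊆ D.carrier → w ∈ meshDomain Ω δ →
        d ≤ dist (meshPoint δ w) (D.pt 0) → d ≤ dist (meshPoint δ w) (D.pt 1) →
          rwVisit (discreteDomainGraph Ω δ) (a δ) (b δ) w ≤ η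

/-- **The line of card `excursion-domination`**: the atom and the two random-walk inputs give the
crux BY NAME through the vertex-by-vertex cascade `∏(1 - h^SAW) ≥ (∏(1 - h^RW))^{2C} = (G_{D'}/G_D)^{2C}`
(elementary: `1 - C x ≥ (1 - x)^{2C}` for `0 ≤ x ≤ 1/(2C)`). -/
def DominationLine : Prop :=
  ExcursionDomination → RWConfinement → RWVisitSmall →
    Summit.CriticalPhenomena.SAWScalingLimit.Theses.SAWRenewalTightness.ConfinementPositivity

/-! ### Card `restriction-cascade`: the super-linear wall-approach atom (flat strip instance) -/

/-- **THE ATOM of card `restriction-cascade`, flat-strip instance `StripWallApproach ε C`.** For the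
critical SAW crossing the rectangle `(0,m) × (0,1)` (mesh `δ`) between lattice points within `2δ`
of the side midpoints, the probability of coming within distance `r` of the top-wall point `(x, 1)`
with `x` in the middle half is at most `C r^{1+ε}` — super-linear in the relative size of the
window; predicted exponent `2` (boundary two-leg exponent, universal among restriction measures:
Kennedy 2002 measured `P(X ≤ t) = 1 - (1 - t²)^{5/8}`), any `ε > 0` suffices for the cascade. -/
def StripWallApproach (ε C : ℝ) : Prop :=
  ∀ (m x r δ : ℝ) (a b : Site 2), 1 ≤ m → m ≤ 4 → 0 < δ → δ ≤ r → r ≤ 1 / 4 →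
    m / 4 ≤ x → x ≤ 3 * m / 4 →
    dist (meshPoint δ a) ⟨0, 1 / 2⟩ ≤ 2 * δ → dist (meshPoint δ b) ⟨m, 1 / 2⟩ ≤ 2 * δ →
      (SAW.law (Set.Ioo (0 : ℝ) m ×ℂ Set.Ioo (0 : ℝ) 1) δ a b
        {γ | ∃ w ∈ γ.walk.support, dist (meshPoint δ w) ⟨x, 1⟩ ≤ r}).toReal ≤ C * r ^ (1 + ε)

/-- The existential form consumed by the Whitney cascade. -/
def SuperlinearWallApproach : Prop := ∃ ε C : ℝ, 0 < ε ∧ StripWallApproach ε C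

end Summit.CriticalPhenomena.SAWScalingLimit.Cruxes.ConfinementPositivity.Ideator1

end
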